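import Literature.Barriers.Parity.LinearSieveOptimality
import Literature.Barriers.Parity.LinearSieveOptimalityInduction
import HarnessLib

/-!
# Discharges of named facts of `LinearSieveOptimality.lean`

`Literature/Barriers/Parity/LinearSieveOptimalityHolds.lean` — proofs-only sibling of
`LinearSieveOptimality.lean` (no definitions, no named facts). Each theorem below closes a
named fact `X : Prop` of that file as `X_holds : X` by composing an ACCEPTED reduction theorem
of the tree with the ACCEPTED unconditional `_holds` discharges of all of its hypotheses;
nothing is re-proved and no statement is changed. Recorded by the librarian sweep g25
(2026-08-16, pass 5c: facts dischargeable in one line from the tree's own lemmas), so that the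
facts census, `#h21_route_deps` and the cone guardrail see these facts as theorems.

Discharged here:

* `LinearSieveOptimalityNarrow_holds` := `linearSieveOptimalityNarrow_of_greaves`
  `Greaves2001_selbergSet_sifted_holds` (`LinearSieveOptimality.lean`).

## References

* [Brady2020PoissonImitators] — see `lean/references.bib` and the docstring of the fact in `LinearSieveOptimality.lean`.
* [Greaves2001] — see `lean/references.bib` and the docstring of the fact in `LinearSieveOptimality.lean`.
* [Selberg1989SiftingProblems] — see `lean/references.bib` and the docstring of the fact in `LinearSieveOptimality.lean`.
-/

namespace Literature.Barriers.Parity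

/-- **Discharge of the named fact `LinearSieveOptimalityNarrow`** (`LinearSieveOptimality.lean`):
`LinearSieveOptimality`, narrowed to its exact reach (test-set form; barrier audit
2026-08-16). For every `s ≥ 1`: … — obtained as `linearSieveOptimalityNarrow_of_greaves`
applied to the tree's unconditional discharge `Greaves2001_selbergSet_sifted_holds` of its
hypothesis (reduction in `LinearSieveOptimality.lean`).
[cite: Greaves2001, §4.5.1 Theorem 1 and notes p. 133]
[cite: Selberg1989SiftingProblems, §4 Theorem 1 (α₁ = ½)]
[cite: Brady2020PoissonImitators, Theorems 1–2] -/
theorem LinearSieveOptimalityNarrow_holds :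
    LinearSieveOptimalityNarrow :=
  linearSieveOptimalityNarrow_of_greaves Greaves2001_selbergSet_sifted_holds

end Literature.Barriers.Parity
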